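import Mathlib
import Literature.Probability.LatticeModels.TransferOperator

/-!
# Twisted-trace comparison (crux `QuarksAsStableAction.StableActionBridge`, line `Sketch`)

Worker stub `stub_twistedTraceComparison` of the lead skeleton for item stmt-QuantumFields-9737
(card `twisted-trace-transfer`, first lemma): the abstract finite-dimensional comparison behind
the passage from honest thermal traces `Tr 𝕋^L` to twisted traces `Tr Γ 𝕋^L`.

For transfer data `(T, Ω)` on a finite-dimensional complex Hilbert space `H` (`T` a positive
contraction with `T Ω = Ω`, `‖Ω‖ = 1`), a contraction `Γ` fixing `Ω` and any bounded `O`,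

  `‖Tr (Γ O T^L) - ⟪Ω, O Ω⟫‖ ≤ ‖O‖ · (Re Tr T^L - 1)`.

Proof: with `P` the orthogonal projection onto the vacuum line and `Q = 1 - P`, one has
`Tr (X P) = ⟪Ω, X Ω⟫` for every `X`, `T^L Q = Q T^L Q =: M` is a positive operator (the powers of
`T` preserve `Ω^⊥`), `Γ† Ω = Ω` (a contraction fixing a unit vector fixes it for the adjoint too),
so `Tr (Γ O T^L) - ⟪Ω, O Ω⟫ = Tr ((Γ O) M)` and `Re Tr T^L - 1 = Re Tr M`; finally
`‖Tr (Y M)‖ ≤ ‖Y‖ · Re Tr M` for positive `M` (write `M = ∑ |uᵢ⟩⟨uᵢ|`).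
-/

namespace Summit.QuantumFields.QCD.Cruxes.StableActionBridge.Sketch

open scoped InnerProductSpace ComplexOrder
open Literature.Probability.LatticeModels

section Helpers

variable {H : Type*} [NormedAddCommGroup H] [InnerProductSpace ℂ H] [CompleteSpace H]

/-- A contraction `Γ` fixing a unit vector `v` has an adjoint fixing `v`:
`‖Γ† v - v‖² = ‖Γ† v‖² - 2 Re ⟪Γ† v, v⟫ + 1 ≤ 1 - 2 + 1 = 0`. -/
private theorem adjoint_apply_eq_self_of_norm_le_one {Γ : H →L[ℂ] H} {v : H} (hΓ : ‖Γ‖ ≤ 1)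
    (hv : ‖v‖ = 1) (hfix : Γ v = v) : (ContinuousLinearMap.adjoint Γ) v = v := by
  have h1 : ‖(ContinuousLinearMap.adjoint Γ) v‖ ≤ 1 := by
    calc ‖(ContinuousLinearMap.adjoint Γ) v‖ ≤ ‖ContinuousLinearMap.adjoint Γ‖ * ‖v‖ :=
          (ContinuousLinearMap.adjoint Γ).le_opNorm v
      _ = ‖Γ‖ := by rw [LinearIsometryEquiv.norm_map, hv, mul_one]
      _ ≤ 1 := hΓ
  have h2 : ⟪(ContinuousLinearMap.adjoint Γ) v, v⟫_ℂ = 1 := by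
    rw [ContinuousLinearMap.adjoint_inner_left, hfix, inner_self_eq_one_of_norm_eq_one hv]
  have h3 : ‖(ContinuousLinearMap.adjoint Γ) v - v‖ ^ 2 ≤ 0 := by
    rw [@norm_sub_sq ℂ, h2, hv, RCLike.one_re]
    nlinarith [h1, norm_nonneg ((ContinuousLinearMap.adjoint Γ) v)]
  have h4 : ‖(ContinuousLinearMap.adjoint Γ) v - v‖ = 0 :=
    le_antisymm (by nlinarith [norm_nonneg ((ContinuousLinearMap.adjoint Γ) v - v)])
      (norm_nonneg _)
  exact sub_eq_zero.mp (norm_eq_zero.mp h4)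

/-- Powers of a positive operator are positive (`T^{L+2} = T ∘ T^L ∘ T†`). -/
private theorem isPositive_pow {T : H →L[ℂ] H} (hT : T.IsPositive) (L : ℕ) :
    (T ^ L).IsPositive := by
  suffices h : ∀ n : ℕ, (T ^ n).IsPositive ∧ (T ^ (n + 1)).IsPositive from (h L).1
  intro n
  induction n with
  | zero =>
    refine ⟨?_, ?_⟩
    · rw [pow_zero]
      exact ContinuousLinearMap.isPositive_one
    · rw [zero_add, pow_one]
      exact hT
  | succ n ih =>
    refine ⟨ih.2, ?_⟩
    have h := ih.1.conj_adjoint T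
    rw [hT.isSelfAdjoint.adjoint_eq, ← ContinuousLinearMap.mul_def,
      ← ContinuousLinearMap.mul_def, ← mul_assoc, ← pow_succ', ← pow_succ] at h
    exact h

omit [CompleteSpace H] in
/-- Core trace inequality: for a positive operator `M` on a finite-dimensional Hilbert space and
any `Y` with `‖Y‖ ≤ c`, `‖Tr (Y M)‖ ≤ c · Re Tr M` (write `M = ∑ᵢ |uᵢ⟩⟨uᵢ|`, so that
`Tr (Y M) = ∑ᵢ ⟪uᵢ, Y uᵢ⟫` and `Tr M = ∑ᵢ ‖uᵢ‖²`). -/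
private theorem norm_trace_mul_le_of_isPositive [FiniteDimensional ℂ H] {M : H →L[ℂ] H}
    (hM : M.IsPositive) (Y : H →L[ℂ] H) {c : ℝ} (hc : ‖Y‖ ≤ c) :
    ‖LinearMap.trace ℂ H ((Y * M : H →L[ℂ] H) : H →ₗ[ℂ] H)‖ ≤
      c * (LinearMap.trace ℂ H (M : H →ₗ[ℂ] H)).re := by
  obtain ⟨m, u, hu⟩ := ContinuousLinearMap.isPositive_iff_eq_sum_rankOne.mp hM
  have h1 : LinearMap.trace ℂ H ((Y * M : H →L[ℂ] H) : H →ₗ[ℂ] H) = ∑ i, ⟪u i, Y (u i)⟫_ℂ := by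
    rw [hu, Finset.mul_sum]
    simp only [ContinuousLinearMap.toLinearMap_sum, map_sum, ContinuousLinearMap.mul_def,
      InnerProductSpace.comp_rankOne, InnerProductSpace.trace_rankOne]
  have h2 : (LinearMap.trace ℂ H (M : H →ₗ[ℂ] H)).re = ∑ i, ‖u i‖ ^ 2 := by
    rw [hu]
    simp only [ContinuousLinearMap.toLinearMap_sum, map_sum, InnerProductSpace.trace_rankOne,
      Complex.re_sum]
    exact Finset.sum_congr rfl fun i _ => inner_self_eq_norm_sq (𝕜 := ℂ) (u i)
  rw [h1, h2, Finset.mul_sum]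
  refine (norm_sum_le _ _).trans (Finset.sum_le_sum fun i _ => ?_)
  calc ‖⟪u i, Y (u i)⟫_ℂ‖ ≤ ‖u i‖ * ‖Y (u i)‖ := norm_inner_le_norm _ _
    _ ≤ ‖u i‖ * (c * ‖u i‖) :=
        mul_le_mul_of_nonneg_left (Y.le_of_opNorm_le hc _) (norm_nonneg _)
    _ = c * ‖u i‖ ^ 2 := by ring

end Helpers

/-- **Twisted-trace comparison** (card `twisted-trace-transfer`, first lemma): for transfer data
`(T, Ω)` on a finite-dimensional Hilbert space (`T` a positive contraction with `T Ω = Ω`,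
`‖Ω‖ = 1`), any contraction `Γ` fixing `Ω` and any bounded insertion `O`,
`‖Tr (Γ O T^L) − ⟪Ω, O Ω⟫‖ ≤ ‖O‖ · (Re Tr T^L − 1)`. -/
theorem stub_twistedTraceComparison :
    ∀ (H : Type) [NormedAddCommGroup H] [InnerProductSpace ℂ H] [CompleteSpace H]
      [FiniteDimensional ℂ H] (D : TransferData H) (Γ O : H →L[ℂ] H),
      ‖Γ‖ ≤ 1 → Γ D.vacuum = D.vacuum → ∀ L : ℕ,
        ‖LinearMap.trace ℂ H ((Γ * O * D.T ^ L : H →L[ℂ] H) : H →ₗ[ℂ] H) -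
            ⟪D.vacuum, O D.vacuum⟫_ℂ‖ ≤
          ‖O‖ * ((LinearMap.trace ℂ H ((D.T ^ L : H →L[ℂ] H) : H →ₗ[ℂ] H)).re - 1) := by
  intro H _ _ _ _ D Γ O hΓ hΓΩ L
  -- the two complementary orthogonal projections and the compressed transfer power
  set P : H →L[ℂ] H := (D.vacuumLine).starProjection with hPdef
  set Q : H →L[ℂ] H := (D.vacuumLine)ᗮ.starProjection with hQdef
  set M : H →L[ℂ] H := Q * D.T ^ L * Q with hMdef
  have hPQ : P + Q = 1 := by
    rw [ContinuousLinearMap.one_def]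
    exact (Submodule.id_eq_sum_starProjection_self_orthogonalComplement (K := D.vacuumLine)).symm
  have hP : P = InnerProductSpace.rankOne ℂ D.vacuum D.vacuum := by
    ext w
    rw [hPdef, TransferData.vacuumLine,
      Submodule.starProjection_unit_singleton ℂ D.norm_vacuum, InnerProductSpace.rankOne_apply]
  -- trace against the vacuum projection is the vacuum expectation
  have htrP : ∀ A : H →L[ℂ] H,
      LinearMap.trace ℂ H ((A * P : H →L[ℂ] H) : H →ₗ[ℂ] H) = ⟪D.vacuum, A D.vacuum⟫_ℂ := by
    intro A
    rw [hP, ContinuousLinearMap.mul_def, InnerProductSpace.comp_rankOne,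
      InnerProductSpace.trace_rankOne]
  -- the powers of `T` preserve `Ω^⊥`, so `T^L Q = Q T^L Q`
  have hTQ : D.T ^ L * Q = M := by
    ext w
    rw [hMdef]
    simp only [mul_apply_eq_comp]
    exact (Submodule.starProjection_eq_self_iff.mpr
      (D.pow_apply_mem_orthogonal_and_norm_le (Submodule.starProjection_apply_mem _ w) L).1).symm
  have hMpos : M.IsPositive := by
    have h := (isPositive_pow D.isPositive L).conj_starProjection (D.vacuumLine)ᗮ
    rw [← ContinuousLinearMap.mul_def, ← ContinuousLinearMap.mul_def, ← mul_assoc] at h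
    exact h
  have hadj : (ContinuousLinearMap.adjoint Γ) D.vacuum = D.vacuum :=
    adjoint_apply_eq_self_of_norm_le_one hΓ D.norm_vacuum hΓΩ
  have hvac : ⟪D.vacuum, Γ (O D.vacuum)⟫_ℂ = ⟪D.vacuum, O D.vacuum⟫_ℂ := by
    rw [← ContinuousLinearMap.adjoint_inner_left Γ (O D.vacuum) D.vacuum, hadj]
  -- trace decomposition of `Γ O T^L`
  have hX : LinearMap.trace ℂ H ((Γ * O * D.T ^ L : H →L[ℂ] H) : H →ₗ[ℂ] H) -
      ⟪D.vacuum, O D.vacuum⟫_ℂ =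
        LinearMap.trace ℂ H ((Γ * O * M : H →L[ℂ] H) : H →ₗ[ℂ] H) := by
    have hsplit : Γ * O * D.T ^ L = Γ * O * D.T ^ L * P + Γ * O * M := by
      calc Γ * O * D.T ^ L = Γ * O * D.T ^ L * (P + Q) := by rw [hPQ, mul_one]
        _ = Γ * O * D.T ^ L * P + Γ * O * (D.T ^ L * Q) := by
            rw [mul_add, mul_assoc (Γ * O) (D.T ^ L) Q]
        _ = Γ * O * D.T ^ L * P + Γ * O * M := by rw [hTQ]
    have happ : (Γ * O * D.T ^ L) D.vacuum = Γ (O D.vacuum) := by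
      simp only [mul_apply_eq_comp]
      rw [D.pow_apply_vacuum]
    rw [hsplit, ContinuousLinearMap.toLinearMap_add, map_add, htrP, happ, hvac]
    ring
  -- trace decomposition of `T^L`
  have hT : (LinearMap.trace ℂ H ((D.T ^ L : H →L[ℂ] H) : H →ₗ[ℂ] H)).re - 1 =
      (LinearMap.trace ℂ H (M : H →ₗ[ℂ] H)).re := by
    have hsplit : D.T ^ L = D.T ^ L * P + M := by
      calc D.T ^ L = D.T ^ L * (P + Q) := by rw [hPQ, mul_one]
        _ = D.T ^ L * P + M := by rw [mul_add, hTQ]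
    rw [hsplit, ContinuousLinearMap.toLinearMap_add, map_add, htrP, D.pow_apply_vacuum,
      inner_self_eq_one_of_norm_eq_one D.norm_vacuum, Complex.add_re, Complex.one_re]
    ring
  rw [hX, hT]
  have hY : ‖Γ * O‖ ≤ ‖O‖ := by
    calc ‖Γ * O‖ ≤ ‖Γ‖ * ‖O‖ := norm_mul_le Γ O
      _ ≤ 1 * ‖O‖ := mul_le_mul_of_nonneg_right hΓ (norm_nonneg O)
      _ = ‖O‖ := one_mul ‖O‖
  exact norm_trace_mul_le_of_isPositive hMpos (Γ * O) hY

end Summit.QuantumFields.QCD.Cruxes.StableActionBridge.Sketch
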